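import Literature.RingTheory.FormalGroups.TypicalUniversalityStep
import HarnessLib

/-!
# `p`-typical universality: every commutative law over a ring with `p` nilpotent is strictly isomorphic to a specialisation of `F_V`
# ([Hazewinkel 1978] §15.2; [Lazard 1955] Théorèmes II–III)

Topic `Literature/RingTheory/FormalGroups`; namespace `Literature.RingTheory.FormalGroups`.  THEOREMS ONLY; no definition,
no named fact, no instance, no `sorry`.

* `exists_formalGroupHom_univTypicalLaw` — **THEOREM.** Let `p` be a prime, `B` a commutative ring in which `p` is nilpotent and
  `G` a commutative one-dimensional formal group law over `B`.  Then there are a ring map `f : ℤ[V] → B` and a STRICT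
  isomorphism `ψ(T) = T + ⋯` from `G` to the specialisation `f_* F_V` of Hazewinkel's universal `p`-typical law
  (`univTypicalLaw p`): `ψ(G(X,Y)) = (f_*F_V)(ψ(X), ψ(Y))`.

Proof (Lazard's degree-by-degree method with the `p`-typical universal law in place of the Lazard ring): starting from
`ψ = T`, `f = 0`, the defect `ψ(G) - f_*F_V(ψX,ψY)` is killed one degree at a time by `TypicalUniversalityStep`
(`budStep_of_ne_pow` / `budStep_of_pow`); the corrections to `ψ` in step `n` are of order `n` and those to `f` touch only
the variable `X_k` with `p^{k+1} = n`, so both converge coefficientwise (`le_order_map_sub_map_univTypicalLaw`), and the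
limit is a strict homomorphism.  Over a ring in which `p` is nilpotent this is Hazewinkel's Thm. «every formal group law over a
`ℤ_(p)`-algebra is strictly isomorphic to a `p`-typical one, and `F_V` is universal for `p`-typical laws» (§15.2, §16.4),
and Lazard's Théorème II–III read through `F_V`.

## References
* [Hazewinkel1978] M. Hazewinkel, *Formal Groups and Applications* (1978), §15.2 (15.2.3)–(15.2.9), §16.4.
* [Lazard1955] M. Lazard, Bull. SMF 83 (1955), Théorème II (p. 255), Théorème III, §II.
-/

noncomputable section

namespace Literature.RingTheory.FormalGroups

open MvPowerSeries Finset Finsupp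

universe u

variable {B : Type u} [CommRing B]

/-! ## §1 Recursively chosen sequences -/

/-- Dependent choice along `ℕ`: from a start satisfying `P 0` and a step `P j s → ∃ s', P (j+1) s' ∧ R j s s'` one gets a
sequence. [folklore] -/
private theorem exists_seq {S : Type*} (P : ℕ → S → Prop) (R : ℕ → S → S → Prop) (s₀ : S) (h0 : P 0 s₀)
    (hstep : ∀ j s, P j s → ∃ s', P (j + 1) s' ∧ R j s s') :
    ∃ seq : ℕ → S, seq 0 = s₀ ∧ (∀ j, P j (seq j)) ∧ ∀ j, R j (seq j) (seq (j + 1)) := by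
  classical
  let next : ℕ → S → S := fun j s => if h : P j s then Classical.choose (hstep j s h) else s
  let seq : ℕ → S := fun j => Nat.rec (motive := fun _ => S) s₀ next j
  have hsucc : ∀ j, seq (j + 1) = next j (seq j) := fun j => rfl
  have hP : ∀ j, P j (seq j) := by
    intro j
    induction j with
    | zero => exact h0
    | succ j ih =>
      rw [hsucc]
      simp only [next, dif_pos ih]
      exact (Classical.choose_spec (hstep j _ ih)).1
  refine ⟨seq, rfl, hP, fun j => ?_⟩
  rw [hsucc]
  simp only [next, dif_pos (hP j)]
  exact (Classical.choose_spec (hstep j _ (hP j))).2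

/-! ## §2 The theorem -/

/-- **`p`-typical universality (Hazewinkel §15.2, §16.4; Lazard Thm. II–III).**  Over a commutative ring `B` in which the prime
`p` is nilpotent, every commutative one-dimensional formal group law `G` is STRICTLY isomorphic to a specialisation of the
universal `p`-typical law: there are `f : ℤ[V] →+* B` and a homomorphism `ψ : G → f_* F_V` with `ψ(T) ≡ T (mod deg 2)`.
[cite: Hazewinkel1978, §15.2] -/
theorem exists_formalGroupHom_univTypicalLaw (p : ℕ) [Fact p.Prime] (hpB : IsNilpotent (p : B)) (G : FormalGroup B)
    [G.IsComm] :
    ∃ (f : MvPolynomial ℕ ℤ →+* B) (ψ : FormalGroupHom G ((univTypicalLaw p).map f)),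
      PowerSeries.coeff 1 ψ.toPowerSeries = 1 := by
  set F := univTypicalLaw p with hF
  let φ : (ℕ → B) → (MvPolynomial ℕ ℤ →+* B) := fun v => MvPolynomial.eval₂Hom (Int.castRingHom B) v
  -- invariant and compatibility
  let P : ℕ → (ℕ → B) × PowerSeries B → Prop := fun j s =>
    PowerSeries.constantCoeff s.2 = 0 ∧ PowerSeries.coeff 1 s.2 = 1 ∧
      ((j + 2 : ℕ) : ℕ∞) ≤ (budDefect G (F.map (φ s.1)) s.2).order
  let R : ℕ → (ℕ → B) × PowerSeries B → (ℕ → B) × PowerSeries B → Prop := fun j s s' =>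
    (∀ k, p ^ (k + 1) ≤ j + 1 → s'.1 k = s.1 k) ∧ (∀ i ≤ j + 1, PowerSeries.coeff i s'.2 = PowerSeries.coeff i s.2)
  -- start
  have h0 : P 0 (fun _ => 0, PowerSeries.X) :=
    ⟨PowerSeries.constantCoeff_X, PowerSeries.coeff_one_X, two_le_order_budDefect_X G _⟩
  -- step
  have hstep : ∀ j s, P j s → ∃ s', P (j + 1) s' ∧ R j s s' := by
    rintro j ⟨v, ψ⟩ ⟨hψ0, hψ1, hΔ⟩
    set n := j + 2 with hn
    by_cases hpow : n = p ^ n.factorization p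
    · -- `n = p^{k+1}`: move the parameter
      have he := factorization_pos_of_eq_pow (p := p) (by omega) hpow
      set k := n.factorization p - 1 with hk
      have hnk : n = p ^ (k + 1) := by rw [hk, Nat.sub_add_cancel he]; exact hpow
      have hΔ' : ((p ^ (k + 1) : ℕ) : ℕ∞) ≤ (budDefect G (F.map (φ v)) ψ).order := by rw [← hnk, hn]; exact hΔ
      obtain ⟨t, ht⟩ := budStep_of_pow p hpB G v hψ0 hψ1 k hΔ'
      refine ⟨(Function.update v k (v k + t), ψ), ⟨hψ0, hψ1, ?_⟩, ?_, fun i _ => rfl⟩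
      · rw [show j + 1 + 2 = p ^ (k + 1) + 1 by omega]; exact ht
      · intro k' hk'
        have hne : k' ≠ k := by
          intro heq
          rw [heq, ← hnk] at hk'
          omega
        exact Function.update_of_ne hne _ _
    · -- `n` not a power of `p`: modify `ψ`
      haveI := univTypicalLaw_isComm p
      haveI := formalGroup_map_isComm (univTypicalLaw p) (φ v)
      obtain ⟨ψ', hψ'0, hψ'1, hlow, hΔ'⟩ := budStep_of_ne_pow p hpB G (F.map (φ v)) hψ0 hψ1 (by omega) hpow hΔ
      exact ⟨(v, ψ'), ⟨hψ'0, hψ'1, hΔ'⟩, fun _ _ => rfl, fun i hi => hlow i (by omega)⟩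
  obtain ⟨seq, hseq0, hP, hR⟩ := exists_seq P R _ h0 hstep
  -- compatibility along the sequence
  have hchain : ∀ j j', j ≤ j' →
      (∀ k, p ^ (k + 1) ≤ j + 1 → (seq j').1 k = (seq j).1 k) ∧
      (∀ i ≤ j + 1, PowerSeries.coeff i (seq j').2 = PowerSeries.coeff i (seq j).2) := by
    intro j j' hjj'
    induction j', hjj' using Nat.le_induction with
    | base => exact ⟨fun _ _ => rfl, fun _ _ => rfl⟩
    | succ j' hj' ih =>
      refine ⟨fun k hk => ?_, fun i hi => ?_⟩
      · rw [(hR j').1 k (by omega), ih.1 k hk]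
      · rw [(hR j').2 i (by omega), ih.2 i hi]
  -- the limit
  let v : ℕ → B := fun k => (seq (p ^ (k + 1) - 1)).1 k
  let ψ : PowerSeries B := PowerSeries.mk fun i => PowerSeries.coeff i (seq i).2
  have hψM : ∀ M i, i ≤ M + 1 → PowerSeries.coeff i ψ = PowerSeries.coeff i (seq M).2 := by
    intro M i hi
    rw [PowerSeries.coeff_mk]
    rcases Nat.lt_or_ge M i with h | h
    · have : i = M + 1 := by omega
      rw [this]; exact (hR M).2 (M + 1) le_rfl
    · exact ((hchain i M h).2 i (by omega)).symm
  have hvM : ∀ M k, p ^ (k + 1) ≤ M + 1 → v k = (seq M).1 k := by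
    intro M k hk
    have hpos : 1 ≤ p ^ (k + 1) := Nat.one_le_pow _ _ (Fact.out : p.Prime).pos
    exact ((hchain (p ^ (k + 1) - 1) M (by omega)).1 k (by omega)).symm
  have hψ0 : PowerSeries.constantCoeff ψ = 0 := by
    rw [← PowerSeries.coeff_zero_eq_constantCoeff_apply, hψM 0 0 (by omega), hseq0,
      PowerSeries.coeff_zero_eq_constantCoeff_apply]
    exact PowerSeries.constantCoeff_X
  have hψ1 : PowerSeries.coeff 1 ψ = 1 := by rw [hψM 0 1 le_rfl]; exact (hP 0).2.1
  -- the defect of the limit vanishes to every order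
  have hkey : ∀ M, ((M + 2 : ℕ) : ℕ∞) ≤ (budDefect G (F.map (φ v)) ψ).order := by
    intro M
    obtain ⟨hM0, -, hMΔ⟩ := hP M
    set vM := (seq M).1 with hvMdef
    set ψM := (seq M).2 with hψMdef
    -- `ψ ≡ ψM (mod deg M+2)`
    have hψψ : ((M + 2 : ℕ) : ℕ∞) ≤ MvPowerSeries.order (ψ - ψM) :=
      natCast_le_order_of_coeff_eq_zero fun i hi => by rw [map_sub, hψM M i (by omega), sub_self]
    -- `φ_v F ≡ φ_{vM} F (mod deg M+2)`
    have hHH : ((M + 1 + 1 : ℕ) : ℕ∞) ≤ ((F.map (φ v)).toPowerSeries - (F.map (φ vM)).toPowerSeries).order :=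
      le_order_map_sub_map_univTypicalLaw p (fun k hk => by
        change MvPolynomial.eval₂Hom _ v (MvPolynomial.X k) = MvPolynomial.eval₂Hom _ vM (MvPolynomial.X k)
        rw [MvPolynomial.eval₂Hom_X', MvPolynomial.eval₂Hom_X', hvM M k hk])
    rw [show M + 1 + 1 = M + 2 by ring] at hHH
    -- compare the defects
    have hψQ : ∀ (Q : MvPowerSeries (Fin 2) B), constantCoeff Q = 0 → ∀ χ : PowerSeries B, PowerSeries.constantCoeff χ = 0 →
        constantCoeff (PowerSeries.subst Q χ) = 0 := fun Q hQ χ hχ => PowerSeries.constantCoeff_subst_eq_zero hQ χ hχ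
    have ha : ∀ i, constantCoeff ((![PowerSeries.subst (X 0 : MvPowerSeries (Fin 2) B) ψ, PowerSeries.subst (X 1) ψ] :
        Fin 2 → MvPowerSeries (Fin 2) B) i) = 0 := by
      intro i; fin_cases i
      · exact hψQ _ (constantCoeff_X 0) ψ hψ0
      · exact hψQ _ (constantCoeff_X 1) ψ hψ0
    have hb : ∀ i, constantCoeff ((![PowerSeries.subst (X 0 : MvPowerSeries (Fin 2) B) ψM, PowerSeries.subst (X 1) ψM] :
        Fin 2 → MvPowerSeries (Fin 2) B) i) = 0 := by
      intro i; fin_cases i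
      · exact hψQ _ (constantCoeff_X 0) ψM hM0
      · exact hψQ _ (constantCoeff_X 1) ψM hM0
    have hab : ∀ i, ((M + 2 : ℕ) : ℕ∞) ≤ (((![PowerSeries.subst (X 0 : MvPowerSeries (Fin 2) B) ψ, PowerSeries.subst (X 1) ψ] :
        Fin 2 → MvPowerSeries (Fin 2) B) i) - (![PowerSeries.subst (X 0 : MvPowerSeries (Fin 2) B) ψM,
          PowerSeries.subst (X 1) ψM] : Fin 2 → MvPowerSeries (Fin 2) B) i).order := by
      intro i; fin_cases i
      · simpa [← PowerSeries.subst_sub (PowerSeries.HasSubst.X _)] using le_order_psubst_of_le_order hψψ (constantCoeff_X 0)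
      · simpa [← PowerSeries.subst_sub (PowerSeries.HasSubst.X _)] using le_order_psubst_of_le_order hψψ (constantCoeff_X 1)
    have t1 : ((M + 2 : ℕ) : ℕ∞) ≤ (PowerSeries.subst G.toPowerSeries ψ - PowerSeries.subst G.toPowerSeries ψM).order := by
      rw [← PowerSeries.subst_sub (hasSubst_formalGroup G)]
      exact le_order_psubst_of_le_order hψψ G.zero_constantCoeff
    have t2 := le_order_subst_sub_subst' (f := (F.map (φ v)).toPowerSeries) ha hb hab
    have t3 : ((M + 2 : ℕ) : ℕ∞) ≤ (((F.map (φ v)).toPowerSeries - (F.map (φ vM)).toPowerSeries).subst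
        ![PowerSeries.subst (X 0 : MvPowerSeries (Fin 2) B) ψM, PowerSeries.subst (X 1) ψM]).order :=
      le_order_subst_of_le_order hHH hb
    rw [subst_sub (hasSubst_of_constantCoeff_zero hb)] at t3
    have e : budDefect G (F.map (φ v)) ψ = budDefect G (F.map (φ vM)) ψM +
        (PowerSeries.subst G.toPowerSeries ψ - PowerSeries.subst G.toPowerSeries ψM)
        - ((F.map (φ v)).toPowerSeries.subst ![PowerSeries.subst (X 0 : MvPowerSeries (Fin 2) B) ψ, PowerSeries.subst (X 1) ψ] -
           (F.map (φ v)).toPowerSeries.subst ![PowerSeries.subst (X 0 : MvPowerSeries (Fin 2) B) ψM, PowerSeries.subst (X 1) ψM])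
        - ((F.map (φ v)).toPowerSeries.subst ![PowerSeries.subst (X 0 : MvPowerSeries (Fin 2) B) ψM, PowerSeries.subst (X 1) ψM] -
           (F.map (φ vM)).toPowerSeries.subst ![PowerSeries.subst (X 0 : MvPowerSeries (Fin 2) B) ψM, PowerSeries.subst (X 1) ψM]) := by
      rw [budDefect_def, budDefect_def]; ring
    rw [e]
    exact natCast_le_order_sub (natCast_le_order_sub (natCast_le_order_add hMΔ t1) t2) t3
  have hzero : budDefect G (F.map (φ v)) ψ = 0 := by
    ext d
    rw [map_zero]
    exact (natCast_le_order_iff.mp (hkey d.degree)) d (by omega)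
  refine ⟨φ v, ⟨ψ, hψ0, ?_⟩, hψ1⟩
  rw [budDefect_def, sub_eq_zero] at hzero
  exact hzero

end Literature.RingTheory.FormalGroups
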